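import Summits.Schanuel.Schanuel.Theorems.SoloInformedRoyTranslateGrowth
import Literature.NumberTheory.Transcendental.RoyCriterionProp3Proofs
import Mathlib.Analysis.Calculus.ContDiff.Bounds
import HarnessLib

/-!
# Roy's criterion: the product step for a band of translates

Roy 2001, Theorem 1 (`Roy2001_thm1_holds`) characterises `α^d = e^{dy}` (condition (a)) by the
existence, for all large `N`, of `Q_N ≠ 0` in the box `deg ≤ (N^{t₀}, N^{t₁})`, `H ≤ e^N`, with
`|(D^kQ_N)(my, α^m)| ≤ e^{-N^u}` for all `k ≤ N^{s₀}`, `m ≤ N^{s₁}` (condition (b)).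
`SoloInformedRoyTranslateSharp` shows that (b) with the translate range cut to `m ≤ N^{s₁-ε}` is
FREE (holds for every `(y, α)`, by Dirichlet's box principle).  This file supplies the gluing step
showing that, conversely, the thin top band `N^{s₁-ε} < m ≤ N^{s₁}` carries ALL the content:

* `eventually_exists_small_of_band_of_low` (**product step**): if (b) holds on a low range
  `m ≤ N^{s_L'}` and on a band `N^{s_L} < m ≤ N^{s₁}` with `s_L ≤ s_L'`, then the products
  `P_N = Q_N^{band} · Q_N^{low}` satisfy (b) on the FULL range `m ≤ N^{s₁}` up to constants
  (`deg ≤ 2N^{tᵢ}`, `H ≤ e^{(4+t₀+t₁)N}`, smallness `e^{-N^u/2}`), provided only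
  `s₀, 1, t₀, s₁ + t₁ < u` (true on Roy's window (1)).  Mechanism: at every translate one factor
  is small to derivative order `N^{s₀}` and the other is bounded by a Cauchy estimate
  (`norm_aeval_iterate_royD_le_of_degreeOf_le`); Leibniz along the flow of
  `D = ∂₀ + X₁∂₁` (`norm_aeval_iterate_royD_mul_le`) gives `|D^k(PQ)| ≤ 2^k ε B`.
* the height of a product (`mvPolyHeight_mul_le`) and the growth numerics.

The rescaling `N ↦ ⌊N^θ⌋` that absorbs the constants, and the resulting **band criterion**
(`(b) on the band N^{s₁-ε} < m ≤ N^{s₁}` `↔ (a)`, for admissible parameters depending on `ε`),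
are in `SoloInformedRoyBandCriterion`.

References: D. Roy, *An arithmetic criterion for the values of the exponential function*,
Acta Arith. 97 (2001), Thm. 1 and §5 [Roy2001]; M. Waldschmidt, *Diophantine approximation on
linear algebraic groups*, Springer 2000, §4 (Dirichlet box principle) [Waldschmidt2000].
-/

noncomputable section

open MvPolynomial Filter Complex Metric
open Literature.NumberTheory.Transcendental

namespace Summit.Schanuel.Schanuel.Theorems


/-! ### Height of a product -/

/-- `H(P) ≤ B` iff every coefficient has absolute value `≤ B`. [cite: Roy2001, §1 (height)] -/
theorem mvPolyHeight_le_iff {σ : Type*} (P : MvPolynomial σ ℤ) (B : ℕ) :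
    mvPolyHeight P ≤ B ↔ ∀ n, (P.coeff n).natAbs ≤ B := by
  unfold mvPolyHeight
  rw [Finset.sup_le_iff]
  refine ⟨fun h n => ?_, fun h n _ => h n⟩
  by_cases hn : n ∈ P.support
  · exact h n hn
  · simp [notMem_support_iff.1 hn]

/-- Height of a product: `H(PQ) ≤ #supp(P) · H(P) · H(Q)`. [folklore] -/
theorem mvPolyHeight_mul_le (P Q : MvPolynomial (Fin 2) ℤ) :
    mvPolyHeight (P * Q) ≤ P.support.card * mvPolyHeight P * mvPolyHeight Q := by
  classical
  rw [mvPolyHeight_le_iff]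
  intro n
  rw [coeff_mul]
  set S := (Finset.antidiagonal n).filter (fun x => x.1 ∈ P.support) with hS
  have hcard : S.card ≤ P.support.card := by
    refine Finset.card_le_card_of_injOn (fun x => x.1) (fun x hx => (Finset.mem_filter.1 hx).2) ?_
    intro x hx x' hx' h
    have hxn := Finset.mem_antidiagonal.1 (Finset.mem_filter.1 hx).1
    have hx'n := Finset.mem_antidiagonal.1 (Finset.mem_filter.1 hx').1
    have h1 : x.1 = x'.1 := h
    have h2 : x.1 + x.2 = x.1 + x'.2 := by rw [hxn, h1, hx'n]
    exact Prod.ext h1 (add_left_cancel h2)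
  calc (∑ x ∈ Finset.antidiagonal n, coeff x.1 P * coeff x.2 Q).natAbs
      ≤ ∑ x ∈ Finset.antidiagonal n, (coeff x.1 P * coeff x.2 Q).natAbs := Int.natAbs_sum_le _ _
    _ = ∑ x ∈ S, (coeff x.1 P).natAbs * (coeff x.2 Q).natAbs := by
        rw [hS, Finset.sum_filter]
        refine Finset.sum_congr rfl fun x _ => ?_
        split_ifs with hx
        · exact Int.natAbs_mul _ _
        · simp [notMem_support_iff.1 hx]
    _ ≤ ∑ _x ∈ S, mvPolyHeight P * mvPolyHeight Q := Finset.sum_le_sum fun x _ =>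
        Nat.mul_le_mul (natAbs_coeff_le_mvPolyHeight P x.1) (natAbs_coeff_le_mvPolyHeight Q x.2)
    _ = S.card * (mvPolyHeight P * mvPolyHeight Q) := by rw [Finset.sum_const, smul_eq_mul]
    _ ≤ P.support.card * (mvPolyHeight P * mvPolyHeight Q) := Nat.mul_le_mul_right _ hcard
    _ = P.support.card * mvPolyHeight P * mvPolyHeight Q := (mul_assoc _ _ _).symm

/-- Height of a product in terms of the partial degrees of the first factor. [folklore] -/
theorem mvPolyHeight_mul_le_real (P Q : MvPolynomial (Fin 2) ℤ) {D₀ D₁ : ℕ}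
    (h0 : P.degreeOf 0 ≤ D₀) (h1 : P.degreeOf 1 ≤ D₁) :
    (mvPolyHeight (P * Q) : ℝ) ≤
      (((D₀ + 1) * (D₁ + 1) : ℕ) : ℝ) * mvPolyHeight P * mvPolyHeight Q := by
  have h := mvPolyHeight_mul_le P Q
  have hc : P.support.card ≤ (D₀ + 1) * (D₁ + 1) :=
    (card_support_le P).trans (Nat.mul_le_mul (by omega) (by omega))
  have h' : mvPolyHeight (P * Q) ≤ (D₀ + 1) * (D₁ + 1) * mvPolyHeight P * mvPolyHeight Q :=
    h.trans (Nat.mul_le_mul_right _ (Nat.mul_le_mul_right _ hc))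
  exact_mod_cast h'

/-! ### Cauchy and Leibniz bounds for `D^k` at a point -/

/-- Cauchy bound for `(D^j Q)(z, ω)` from the partial degrees and the height of `Q`:
`|(D^jQ)(z,ω)| ≤ j! (D₀+1)(D₁+1) H(Q) (1+|z|)^{D₀} (e(1+|ω|))^{D₁}` (Cauchy on `|s| = 1` along
the flow `s ↦ (z+s, ωe^s)` of `D`). [folklore; cf. Roy2001, §5 (p. 194)] -/
theorem norm_aeval_iterate_royD_le_of_degreeOf_le (j : ℕ) (Q : MvPolynomial (Fin 2) ℤ)
    {D₀ D₁ : ℕ} (h0 : Q.degreeOf 0 ≤ D₀) (h1 : Q.degreeOf 1 ≤ D₁) (z ω : ℂ) :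
    ‖aeval ![z, ω] (royD^[j] Q)‖ ≤ j.factorial * ((((D₀ + 1) * (D₁ + 1) : ℕ) : ℝ) *
      mvPolyHeight Q * (1 + ‖z‖) ^ D₀ * (Real.exp 1 * (1 + ‖ω‖)) ^ D₁) := by
  set f : ℂ → ℂ := fun s => aeval ![z + s, ω * cexp s] Q with hf
  have hdiff : Differentiable ℂ f := fun s =>
    (hasDerivAt_aeval_add_mul_exp Q z ω s).differentiableAt
  have hval : aeval ![z, ω] (royD^[j] Q) = iteratedDeriv j f 0 := by
    rw [hf, iteratedDeriv_aeval_add_mul_exp]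
    simp
  have h1z : (1 : ℝ) ≤ 1 + ‖z‖ := by linarith [norm_nonneg z]
  have h1ω : (1 : ℝ) ≤ Real.exp 1 * (1 + ‖ω‖) :=
    one_le_mul_of_one_le_of_one_le (Real.one_le_exp zero_le_one) (by linarith [norm_nonneg ω])
  have hC : ∀ s ∈ sphere (0 : ℂ) 1, ‖f s‖ ≤ (((D₀ + 1) * (D₁ + 1) : ℕ) : ℝ) * mvPolyHeight Q *
      (1 + ‖z‖) ^ D₀ * (Real.exp 1 * (1 + ‖ω‖)) ^ D₁ := by
    intro s hs
    have hs1 : ‖s‖ = 1 := by simpa using hs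
    have hz : ‖z + s‖ ≤ 1 + ‖z‖ := by
      calc ‖z + s‖ ≤ ‖z‖ + ‖s‖ := norm_add_le _ _
        _ = 1 + ‖z‖ := by rw [hs1, add_comm]
    have hω : ‖ω * cexp s‖ ≤ Real.exp 1 * (1 + ‖ω‖) := by
      rw [norm_mul, Complex.norm_exp]
      have he : Real.exp s.re ≤ Real.exp 1 := Real.exp_le_exp.2 ((re_le_norm s).trans hs1.le)
      calc ‖ω‖ * Real.exp s.re ≤ (1 + ‖ω‖) * Real.exp 1 :=
            mul_le_mul (by linarith [norm_nonneg ω]) he (Real.exp_pos _).le (by positivity)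
        _ = Real.exp 1 * (1 + ‖ω‖) := mul_comm _ _
    exact norm_aeval_le_of_degreeOf_le Q h0 h1 (z + s) (ω * cexp s) hz hω h1z h1ω
  have h := Complex.norm_iteratedDeriv_le_of_forall_mem_sphere_norm_le (f := f) j one_pos
    hdiff.diffContOnCl hC
  rw [hval]
  simpa using h

/-- Leibniz bound: if `|(D^iP)(z,ω)| ≤ ε` and `|(D^iQ)(z,ω)| ≤ B` for all `i ≤ k`, then
`|(D^k(PQ))(z,ω)| ≤ 2^k ε B` (Leibniz along the flow of `D`). [folklore] -/
theorem norm_aeval_iterate_royD_mul_le (P Q : MvPolynomial (Fin 2) ℤ) (z ω : ℂ) (k : ℕ)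
    {ε B : ℝ} (hε : 0 ≤ ε) (hP : ∀ i ≤ k, ‖aeval ![z, ω] (royD^[i] P)‖ ≤ ε)
    (hQ : ∀ i ≤ k, ‖aeval ![z, ω] (royD^[i] Q)‖ ≤ B) :
    ‖aeval ![z, ω] (royD^[k] (P * Q))‖ ≤ 2 ^ k * (ε * B) := by
  set f : ℂ → ℂ := fun s => aeval ![z + s, ω * cexp s] P with hf
  set g : ℂ → ℂ := fun s => aeval ![z + s, ω * cexp s] Q with hg
  have hfd : ContDiff ℂ k f := Differentiable.contDiff fun s =>
    (hasDerivAt_aeval_add_mul_exp P z ω s).differentiableAt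
  have hgd : ContDiff ℂ k g := Differentiable.contDiff fun s =>
    (hasDerivAt_aeval_add_mul_exp Q z ω s).differentiableAt
  have hfg : (fun s => aeval ![z + s, ω * cexp s] (P * Q)) = fun s => f s * g s := by
    funext s
    simp only [hf, hg, map_mul]
  have hval : aeval ![z, ω] (royD^[k] (P * Q)) = iteratedDeriv k (fun s => f s * g s) 0 := by
    rw [← hfg, iteratedDeriv_aeval_add_mul_exp]
    simp
  have hvf : ∀ i, ‖iteratedFDeriv ℂ i f 0‖ = ‖aeval ![z, ω] (royD^[i] P)‖ := fun i => by
    rw [norm_iteratedFDeriv_eq_norm_iteratedDeriv, hf, iteratedDeriv_aeval_add_mul_exp]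
    simp
  have hvg : ∀ i, ‖iteratedFDeriv ℂ i g 0‖ = ‖aeval ![z, ω] (royD^[i] Q)‖ := fun i => by
    rw [norm_iteratedFDeriv_eq_norm_iteratedDeriv, hg, iteratedDeriv_aeval_add_mul_exp]
    simp
  have hle := norm_iteratedFDeriv_mul_le hfd hgd (0 : ℂ) (n := k) le_rfl
  rw [hval, ← norm_iteratedFDeriv_eq_norm_iteratedDeriv]
  refine hle.trans ?_
  calc ∑ i ∈ Finset.range (k + 1), (k.choose i : ℝ) * ‖iteratedFDeriv ℂ i f 0‖ *
        ‖iteratedFDeriv ℂ (k - i) g 0‖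
      ≤ ∑ i ∈ Finset.range (k + 1), (k.choose i : ℝ) * (ε * B) := by
        refine Finset.sum_le_sum fun i hi => ?_
        have hik : i ≤ k := Nat.lt_succ_iff.1 (Finset.mem_range.1 hi)
        rw [hvf, hvg, mul_assoc]
        exact mul_le_mul_of_nonneg_left
          (mul_le_mul (hP i hik) (hQ (k - i) (Nat.sub_le k i)) (norm_nonneg _) hε)
          (Nat.cast_nonneg _)
    _ = 2 ^ k * (ε * B) := by
        rw [← Finset.sum_mul]
        congr 1
        exact_mod_cast Nat.sum_range_choose k

/-! ### Two growth inequalities at the translates -/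

/-- `1 + |m y| ≤ (1 + M₁)(1 + |y|)` for `m ≤ M₁`. [folklore] -/
theorem one_add_norm_natCast_mul_le {m M₁ : ℕ} (hm : m ≤ M₁) (y : ℂ) :
    1 + ‖(m : ℂ) * y‖ ≤ (1 + M₁) * (1 + ‖y‖) := by
  rw [norm_mul, Complex.norm_natCast]
  have hmR : (m : ℝ) ≤ M₁ := by exact_mod_cast hm
  have e : (1 + (M₁ : ℝ)) * (1 + ‖y‖) = 1 + ‖y‖ + M₁ + M₁ * ‖y‖ := by ring
  have : (m : ℝ) * ‖y‖ ≤ M₁ * ‖y‖ := mul_le_mul_of_nonneg_right hmR (norm_nonneg y)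
  linarith [norm_nonneg y, (Nat.cast_nonneg M₁ : (0 : ℝ) ≤ M₁)]

/-- `e (1 + |α^m|) ≤ 2 e (1 + |α|)^{M₁}` for `m ≤ M₁`. [folklore] -/
theorem exp_one_mul_one_add_norm_pow_le {m M₁ : ℕ} (hm : m ≤ M₁) (α : ℂ) :
    Real.exp 1 * (1 + ‖α ^ m‖) ≤ 2 * (Real.exp 1 * (1 + ‖α‖) ^ M₁) := by
  rw [norm_pow]
  have h1α : (1 : ℝ) ≤ 1 + ‖α‖ := by linarith [norm_nonneg α]
  have h1 : ‖α‖ ^ m ≤ (1 + ‖α‖) ^ M₁ :=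
    (pow_le_pow_left₀ (norm_nonneg α) (by linarith) m).trans (pow_le_pow_right₀ h1α hm)
  have h2 : (1 : ℝ) ≤ (1 + ‖α‖) ^ M₁ := one_le_pow₀ h1α
  calc Real.exp 1 * (1 + ‖α‖ ^ m) ≤ Real.exp 1 * (2 * (1 + ‖α‖) ^ M₁) :=
        mul_le_mul_of_nonneg_left (by linarith) (Real.exp_pos 1).le
    _ = 2 * (Real.exp 1 * (1 + ‖α‖) ^ M₁) := by ring

/-! ### Numerics -/

/-- Growth bookkeeping for the product step: eventually
`log 2·x^{s₀} + (s₀/ε₀)x^{s₀+ε₀} + (log 4 + (t₀+t₁)x) + x + (…log G…) ≤ x^u/2`, valid as soon as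
`s₀, 1, t₀, s₁ + t₁ < u`. [folklore] -/
theorem eventually_band_numerics {s₀ s₁ t₀ t₁ u ε₀ ε₁ : ℝ} (hs₁ : 0 ≤ s₁)
    (hu : 0 < u) (hs₀u : s₀ < u) (h1u : 1 < u) (ht₀u : t₀ < u) (hst : s₁ + t₁ < u)
    (hε₀ : s₀ + ε₀ < u) (hε₁ : t₀ + ε₁ < u) (Ly Lα : ℝ) :
    ∀ᶠ x : ℝ in atTop, 1 ≤ x ∧
      Real.log 2 * x ^ s₀ + s₀ / ε₀ * x ^ (s₀ + ε₀) + (Real.log 4 + (t₀ + t₁) * x) + x +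
        ((Real.log 2 + Ly) * x ^ t₀ + s₁ / ε₁ * x ^ (t₀ + ε₁) +
          ((Real.log 2 + 1) * x ^ t₁ + Lα * x ^ (t₁ + s₁))) ≤ x ^ u / 2 := by
  have q : (0 : ℝ) < 1 / 18 := by norm_num
  have A₁ := eventually_mul_rpow_le_mul_rpow (Real.log 2) hs₀u q
  have A₂ := eventually_mul_rpow_le_mul_rpow (s₀ / ε₀) hε₀ q
  have A₃ := eventually_mul_rpow_le_mul_rpow (Real.log 4) hu q
  have A₄ := eventually_mul_rpow_le_mul_rpow (t₀ + t₁) h1u q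
  have A₅ := eventually_mul_rpow_le_mul_rpow 1 h1u q
  have A₆ := eventually_mul_rpow_le_mul_rpow (Real.log 2 + Ly) ht₀u q
  have A₇ := eventually_mul_rpow_le_mul_rpow (s₁ / ε₁) hε₁ q
  have A₈ := eventually_mul_rpow_le_mul_rpow (Real.log 2 + 1) (show t₁ < u by linarith) q
  have A₉ := eventually_mul_rpow_le_mul_rpow Lα (show t₁ + s₁ < u by linarith) q
  filter_upwards [eventually_ge_atTop 1, A₁, A₂, A₃, A₄, A₅, A₆, A₇, A₈, A₉]
    with x hx B₁ B₂ B₃ B₄ B₅ B₆ B₇ B₈ B₉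
  refine ⟨hx, ?_⟩
  have hx0 : 0 < x := one_pos.trans_le hx
  rw [Real.rpow_zero] at B₃
  rw [Real.rpow_one] at B₄ B₅
  linarith

/-! ### The product step -/

/-- **Product step.** If condition (b) holds on the low range `m ≤ N^{s_L'}` (witness `Q_N^{low}`)
and on the band `N^{s_L} < m ≤ N^{s₁}` (witness `Q_N^{band}`), `s_L ≤ s_L'`, and
`s₀, 1, t₀, s₁ + t₁ < u`, then `P_N = Q_N^{band} Q_N^{low}` has `deg ≤ (2N^{t₀}, 2N^{t₁})`,
`H(P_N) ≤ e^{(4+t₀+t₁)N}` and `|(D^kP_N)(my, α^m)| ≤ e^{-N^u/2}` for ALL `k ≤ N^{s₀}`, `m ≤ N^{s₁}`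
(Leibniz: at each translate one factor is small to order `N^{s₀}`, the other is bounded by Cauchy).
[folklore; cf. Roy2001, Thm. 1] -/
theorem eventually_exists_small_of_band_of_low (y α : ℂ) {s₀ s₁ sL sL' t₀ t₁ u : ℝ}
    (ht₀ : 0 < t₀) (ht₁ : 0 < t₁) (hs₀ : 0 < s₀) (hs₁ : 0 ≤ s₁) (hs₀u : s₀ < u) (h1u : 1 < u)
    (ht₀u : t₀ < u) (hst : s₁ + t₁ < u) (hLL : sL ≤ sL')
    (hlow : RoyConditionB y α s₀ sL' t₀ t₁ u)
    (hband : ∀ᶠ N : ℕ in atTop, ∃ Q : MvPolynomial (Fin 2) ℤ, Q ≠ 0 ∧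
      (Q.degreeOf 0 : ℝ) ≤ (N : ℝ) ^ t₀ ∧ (Q.degreeOf 1 : ℝ) ≤ (N : ℝ) ^ t₁ ∧
      (mvPolyHeight Q : ℝ) ≤ Real.exp N ∧
      ∀ k m : ℕ, (k : ℝ) ≤ (N : ℝ) ^ s₀ → (N : ℝ) ^ sL < m → (m : ℝ) ≤ (N : ℝ) ^ s₁ →
        ‖aeval ![(m : ℂ) * y, α ^ m] (royD^[k] Q)‖ ≤ Real.exp (-(N : ℝ) ^ u)) :
    ∀ᶠ N : ℕ in atTop, ∃ P : MvPolynomial (Fin 2) ℤ, P ≠ 0 ∧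
      (P.degreeOf 0 : ℝ) ≤ 2 * (N : ℝ) ^ t₀ ∧ (P.degreeOf 1 : ℝ) ≤ 2 * (N : ℝ) ^ t₁ ∧
      (mvPolyHeight P : ℝ) ≤ Real.exp ((4 + t₀ + t₁) * N) ∧
      ∀ k m : ℕ, (k : ℝ) ≤ (N : ℝ) ^ s₀ → (m : ℝ) ≤ (N : ℝ) ^ s₁ →
        ‖aeval ![(m : ℂ) * y, α ^ m] (royD^[k] P)‖ ≤ Real.exp (-(N : ℝ) ^ u / 2) := by
  set ε₀ : ℝ := (u - s₀) / 2 with hε₀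
  set ε₁ : ℝ := (u - t₀) / 2 with hε₁
  have hε₀0 : 0 < ε₀ := by rw [hε₀]; linarith
  have hε₁0 : 0 < ε₁ := by rw [hε₁]; linarith
  have hnum := eventually_band_numerics hs₁ (by linarith) hs₀u h1u ht₀u hst
    (show s₀ + ε₀ < u by rw [hε₀]; linarith) (show t₀ + ε₁ < u by rw [hε₁]; linarith)
    (Real.log (1 + ‖y‖)) (Real.log (1 + ‖α‖))
  unfold RoyConditionB at hlow
  filter_upwards [hlow, hband, tendsto_natCast_atTop_atTop.eventually hnum] with N hl hb hN
  obtain ⟨Ql, hQl0, hl0, hl1, hlH, hlsmall⟩ := hl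
  obtain ⟨Qb, hQb0, hb0, hb1, hbH, hbsmall⟩ := hb
  obtain ⟨hx1, hmain⟩ := hN
  set x : ℝ := (N : ℝ) with hxdef
  have hx0 : 0 < x := one_pos.trans_le hx1
  set T₀ : ℕ := ⌊x ^ t₀⌋₊ with hT₀
  set T₁ : ℕ := ⌊x ^ t₁⌋₊ with hT₁
  set K : ℕ := ⌊x ^ s₀⌋₊ with hK
  set M₁ : ℕ := ⌊x ^ s₁⌋₊ with hM₁
  have hT₀le : (T₀ : ℝ) ≤ x ^ t₀ := Nat.floor_le (Real.rpow_nonneg hx0.le _)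
  have hT₁le : (T₁ : ℝ) ≤ x ^ t₁ := Nat.floor_le (Real.rpow_nonneg hx0.le _)
  have hKle : (K : ℝ) ≤ x ^ s₀ := Nat.floor_le (Real.rpow_nonneg hx0.le _)
  have hM₁le : (M₁ : ℝ) ≤ x ^ s₁ := Nat.floor_le (Real.rpow_nonneg hx0.le _)
  have hdl0 : Ql.degreeOf 0 ≤ T₀ := Nat.le_floor hl0
  have hdl1 : Ql.degreeOf 1 ≤ T₁ := Nat.le_floor hl1
  have hdb0 : Qb.degreeOf 0 ≤ T₀ := Nat.le_floor hb0
  have hdb1 : Qb.degreeOf 1 ≤ T₁ := Nat.le_floor hb1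
  -- the uniform Cauchy bound at the translates
  set G : ℝ := ((1 + M₁) * (1 + ‖y‖)) ^ T₀ * (2 * (Real.exp 1 * (1 + ‖α‖) ^ M₁)) ^ T₁ with hG
  set Bnd : ℝ := K.factorial * ((((T₀ + 1) * (T₁ + 1) : ℕ) : ℝ) * Real.exp x * G) with hBnd
  have hbound : ∀ Q : MvPolynomial (Fin 2) ℤ, Q.degreeOf 0 ≤ T₀ → Q.degreeOf 1 ≤ T₁ →
      (mvPolyHeight Q : ℝ) ≤ Real.exp x → ∀ j m : ℕ, j ≤ K → m ≤ M₁ →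
      ‖aeval ![(m : ℂ) * y, α ^ m] (royD^[j] Q)‖ ≤ Bnd := by
    intro Q hq0 hq1 hqH j m hj hm
    refine (norm_aeval_iterate_royD_le_of_degreeOf_le j Q hq0 hq1 _ _).trans ?_
    have hfact : (j.factorial : ℝ) ≤ K.factorial := by exact_mod_cast Nat.factorial_le hj
    rw [hBnd, hG]
    refine mul_le_mul hfact ?_ (by positivity) (by positivity)
    have hy' := pow_le_pow_left₀ (by positivity) (one_add_norm_natCast_mul_le hm y) T₀
    have hα' := pow_le_pow_left₀ (by positivity) (exp_one_mul_one_add_norm_pow_le hm α) T₁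
    calc (((T₀ + 1) * (T₁ + 1) : ℕ) : ℝ) * mvPolyHeight Q * (1 + ‖(m : ℂ) * y‖) ^ T₀ *
          (Real.exp 1 * (1 + ‖α ^ m‖)) ^ T₁
        ≤ (((T₀ + 1) * (T₁ + 1) : ℕ) : ℝ) * Real.exp x * ((1 + M₁) * (1 + ‖y‖)) ^ T₀ *
          (2 * (Real.exp 1 * (1 + ‖α‖) ^ M₁)) ^ T₁ := by gcongr
      _ = _ := by ring
  -- `2^K e^{-x^u} Bnd ≤ e^{-x^u/2}`
  have h2K : (2 : ℝ) ^ K ≤ Real.exp (Real.log 2 * x ^ s₀) := by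
    rw [← Real.rpow_natCast, Real.rpow_def_of_pos two_pos]
    exact Real.exp_le_exp.2 (mul_le_mul_of_nonneg_left hKle (Real.log_nonneg one_le_two))
  have hBexp : Bnd ≤ Real.exp (s₀ / ε₀ * x ^ (s₀ + ε₀) + (Real.log 4 + (t₀ + t₁) * x) + x +
      ((Real.log 2 + Real.log (1 + ‖y‖)) * x ^ t₀ + s₁ / ε₁ * x ^ (t₀ + ε₁) +
        ((Real.log 2 + 1) * x ^ t₁ + Real.log (1 + ‖α‖) * x ^ (t₁ + s₁)))) := by
    have hGle : G ≤ Real.exp ((Real.log 2 + Real.log (1 + ‖y‖)) * x ^ t₀ +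
        s₁ / ε₁ * x ^ (t₀ + ε₁) +
        ((Real.log 2 + 1) * x ^ t₁ + Real.log (1 + ‖α‖) * x ^ (t₁ + s₁))) := by
      rw [hG]
      exact translate_coeff_bound_le_exp hx1 hs₁ hε₁0 hT₀le hT₁le hM₁le y α
    have hKf : (K.factorial : ℝ) ≤ Real.exp (s₀ / ε₀ * x ^ (s₀ + ε₀)) :=
      factorial_le_exp_rpow hx1 hs₀ hε₀0 hKle
    have hcardle : ((((T₀ + 1) * (T₁ + 1) : ℕ) : ℝ)) ≤ Real.exp (Real.log 4 + (t₀ + t₁) * x) :=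
      card_monomials_le_exp hx1 ht₀.le ht₁.le hT₀le hT₁le
    have hG0 : 0 ≤ G := by rw [hG]; positivity
    calc Bnd = K.factorial * ((((T₀ + 1) * (T₁ + 1) : ℕ) : ℝ) * Real.exp x * G) := hBnd
      _ ≤ Real.exp (s₀ / ε₀ * x ^ (s₀ + ε₀)) * (Real.exp (Real.log 4 + (t₀ + t₁) * x) *
          Real.exp x * Real.exp ((Real.log 2 + Real.log (1 + ‖y‖)) * x ^ t₀ +
            s₁ / ε₁ * x ^ (t₀ + ε₁) +
            ((Real.log 2 + 1) * x ^ t₁ + Real.log (1 + ‖α‖) * x ^ (t₁ + s₁)))) := by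
          gcongr
      _ = _ := by simp only [← Real.exp_add]; ring_nf
  have hsmallnum : (2 : ℝ) ^ K * (Real.exp (-x ^ u) * Bnd) ≤ Real.exp (-x ^ u / 2) := by
    calc (2 : ℝ) ^ K * (Real.exp (-x ^ u) * Bnd)
        ≤ Real.exp (Real.log 2 * x ^ s₀) * (Real.exp (-x ^ u) * Real.exp (s₀ / ε₀ * x ^ (s₀ + ε₀) +
          (Real.log 4 + (t₀ + t₁) * x) + x +
          ((Real.log 2 + Real.log (1 + ‖y‖)) * x ^ t₀ + s₁ / ε₁ * x ^ (t₀ + ε₁) +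
            ((Real.log 2 + 1) * x ^ t₁ + Real.log (1 + ‖α‖) * x ^ (t₁ + s₁))))) :=
          mul_le_mul h2K (mul_le_mul_of_nonneg_left hBexp (Real.exp_pos _).le) (by positivity)
            (by positivity)
      _ ≤ Real.exp (-x ^ u / 2) := by
          rw [← Real.exp_add, ← Real.exp_add]
          exact Real.exp_le_exp.2 (by linarith)
  -- the product
  refine ⟨Qb * Ql, mul_ne_zero hQb0 hQl0, ?_, ?_, ?_, ?_⟩
  · calc ((Qb * Ql).degreeOf 0 : ℝ) ≤ ((Qb.degreeOf 0 + Ql.degreeOf 0 : ℕ) : ℝ) := by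
          exact_mod_cast degreeOf_mul_le 0 Qb Ql
      _ ≤ 2 * x ^ t₀ := by push_cast; linarith
  · calc ((Qb * Ql).degreeOf 1 : ℝ) ≤ ((Qb.degreeOf 1 + Ql.degreeOf 1 : ℕ) : ℝ) := by
          exact_mod_cast degreeOf_mul_le 1 Qb Ql
      _ ≤ 2 * x ^ t₁ := by push_cast; linarith
  · have hlog4 : Real.log 4 ≤ 2 := by
      have := Real.log_le_sub_one_of_pos (show (0:ℝ) < 4 by norm_num)
      -- crude: log 4 ≤ 3; refine: log 4 = 2 log 2 ≤ 2
      rw [show (4:ℝ) = 2 ^ 2 by norm_num, Real.log_pow]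
      have h2 : Real.log 2 ≤ 1 := by
        have := Real.log_le_sub_one_of_pos (show (0:ℝ) < 2 by norm_num); linarith
      push_cast; linarith
    calc (mvPolyHeight (Qb * Ql) : ℝ)
        ≤ (((T₀ + 1) * (T₁ + 1) : ℕ) : ℝ) * mvPolyHeight Qb * mvPolyHeight Ql :=
          mvPolyHeight_mul_le_real Qb Ql hdb0 hdb1
      _ ≤ Real.exp (Real.log 4 + (t₀ + t₁) * x) * Real.exp x * Real.exp x :=
          mul_le_mul (mul_le_mul (card_monomials_le_exp hx1 ht₀.le ht₁.le hT₀le hT₁le) hbH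
            (by positivity) (by positivity)) hlH (by positivity) (by positivity)
      _ ≤ Real.exp ((4 + t₀ + t₁) * x) := by
          rw [← Real.exp_add, ← Real.exp_add]
          exact Real.exp_le_exp.2 (by nlinarith)
  · intro k m hk hm
    have hkK : k ≤ K := Nat.le_floor hk
    have hmM : m ≤ M₁ := Nat.le_floor hm
    have hexp0 : (0 : ℝ) ≤ Real.exp (-x ^ u) := (Real.exp_pos _).le
    have h2k : (2 : ℝ) ^ k ≤ 2 ^ K := pow_le_pow_right₀ one_le_two hkK
    by_cases hband' : x ^ sL < (m : ℝ)
    · -- band point: `Qb` small, `Ql` bounded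
      have hP : ∀ i ≤ k, ‖aeval ![(m : ℂ) * y, α ^ m] (royD^[i] Qb)‖ ≤ Real.exp (-x ^ u) :=
        fun i hi => hbsmall i m ((Nat.cast_le.2 hi).trans hk) hband' hm
      have hQ : ∀ i ≤ k, ‖aeval ![(m : ℂ) * y, α ^ m] (royD^[i] Ql)‖ ≤ Bnd :=
        fun i hi => hbound Ql hdl0 hdl1 hlH i m (hi.trans hkK) hmM
      calc ‖aeval ![(m : ℂ) * y, α ^ m] (royD^[k] (Qb * Ql))‖
          ≤ 2 ^ k * (Real.exp (-x ^ u) * Bnd) :=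
            norm_aeval_iterate_royD_mul_le Qb Ql _ _ k hexp0 hP hQ
        _ ≤ 2 ^ K * (Real.exp (-x ^ u) * Bnd) := by gcongr
        _ ≤ Real.exp (-x ^ u / 2) := hsmallnum
    · -- low point: `Ql` small, `Qb` bounded
      have hmL : (m : ℝ) ≤ x ^ sL' :=
        (not_lt.1 hband').trans (Real.rpow_le_rpow_of_exponent_le hx1 hLL)
      have hP : ∀ i ≤ k, ‖aeval ![(m : ℂ) * y, α ^ m] (royD^[i] Ql)‖ ≤ Real.exp (-x ^ u) :=
        fun i hi => hlsmall i m ((Nat.cast_le.2 hi).trans hk) hmL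
      have hQ : ∀ i ≤ k, ‖aeval ![(m : ℂ) * y, α ^ m] (royD^[i] Qb)‖ ≤ Bnd :=
        fun i hi => hbound Qb hdb0 hdb1 hbH i m (hi.trans hkK) hmM
      rw [mul_comm Qb Ql]
      calc ‖aeval ![(m : ℂ) * y, α ^ m] (royD^[k] (Ql * Qb))‖
          ≤ 2 ^ k * (Real.exp (-x ^ u) * Bnd) :=
            norm_aeval_iterate_royD_mul_le Ql Qb _ _ k hexp0 hP hQ
        _ ≤ 2 ^ K * (Real.exp (-x ^ u) * Bnd) := by gcongr
        _ ≤ Real.exp (-x ^ u / 2) := hsmallnum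

end Summit.Schanuel.Schanuel.Theorems

end
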